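import Literature.NumberTheory.Rogawski1990.UnipotentOrbitalMeasuresExistCM          -- ★ p849138 (LH3-p02 (g0)) «RAO-EX»: existence GIVEN the centraliser property `hcent`
import Literature.NumberTheory.Rogawski1990.UnitaryThreeUnipotentCentralizerBounded  -- ★ p849215 (LH4-p03 (g3)) «CENT-BDD»: the centraliser property at every non-split place
import HarnessLib

/-!
# Invariant orbital measures EXIST at the unipotent classes of `U(Φ₃)(L⁺_v)` at every NON-SPLIT place — unconditionally
(Ranga Rao (1972), Thm. p. 505, existence half; Rogawski (1990), §3.9 p. 32, §4.9 p. 54, §8.1 p. 112)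

Topic `NumberTheory/Rogawski1990`; namespace `Literature.NumberTheory.Rogawski1990`.  THEOREMS ONLY (no definition, no instance, no notation, no named fact,
no `sorry`).  Cell `pub/hodgecm-mathlib`, crux H413 = `stmt-HodgeConjecture-24833`, line LH4 (closer stub `stub_N6ns`), Shalika pay-down organ ‹RAO›, brick
«RAO-EX-UNCOND» (dealer LH4-plan (g2), words #15): the composition of ★ «RAO-EX» (`UnitaryGroup.exists_orbitalMeasureFamily_isAdmissibleOn_unipotent_antidiagOne_three`,
existence of an orbital-measure family ADMISSIBLE at the unipotent classes of `G = U(Φ₃)(L⁺_v)` GIVEN that every element of the centraliser of a unipotent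
`γ ≠ 1` lies in a compact subgroup) with ★ «CENT-BDD» (`exists_isCompact_subgroup_of_mem_centralizer_unipotent`, that property at every non-split place) —
the hypothesis `hcent` is DISCHARGED:

* `UnitaryGroup.exists_orbitalMeasureFamily_isAdmissibleOn_unipotent_antidiagOne_three_nonsplit` — at a non-split `v` (`Subsingleton (PlacesOver L v)`, `w ∣ v`):
  `∃ mU, mU.IsAdmissibleOn (fun γ => (γ − 1)³ = 0) ∧ ∀ c, (out c − 1)³ = 0 → (mU c).Regular`; no oddness hypothesis;
* `UnitaryGroup.exists_orbitalMeasureFamily_isAdmissibleOn_unipotent_antidiagOne_three_odd'` — the same in the binder prefix of `stub_ShRao` (`∀ L v w, Subsingleton →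
  IsUnit 2 → ∀ [instances], …`; the oddness binder is idle for existence and kept only so that the organ closer reads `obtain ⟨mU, hmU, -⟩ := …_odd' L v w hsub h2`).

What remains of ‹RAO› after this file is the CONVERGENCE half (the Ranga Rao clause: `y ↦ f(y u y⁻¹)` is `mU u`-integrable for `f ∈ C_c^∞(G)`), organ «RAO-CONV».
HONEST LABEL: count-neutral, pays no letter by itself; HC_CM is proved only modulo the 7 printed citations (2 remaining: hLiu418 = stmt-HodgeConjecture-24832, h413 =
stmt-HodgeConjecture-24833) until rung 0 closes.

## References
* [Rao1972] R. Ranga Rao, *Orbital integrals in reductive groups*, Ann. of Math. (2) 96 (1972) 505–510, Theorem (existence half).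
* [Rogawski1990] J. D. Rogawski, *Automorphic Representations of Unitary Groups in Three Variables*, Ann. of Math. Stud. 123 (1990): §3.9 p. 32, §4.9 p. 54, §8.1 p. 112.
-/

set_option autoImplicit false

noncomputable section

open NumberField IsDedekindDomain
open scoped Matrix MatrixGroups ValuativeRel

namespace Literature.NumberTheory.Rogawski1990

open Literature.NumberTheory.Automorphic Literature.NumberTheory.Automorphic.UnitaryGroup Literature.NumberTheory.GaloisRepresentations

section CM

variable (L : Type) [Field L] [NumberField L] [IsCMField L]

set_option maxHeartbeats 400000 in
-- statement-heavy: four instance binders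
/-- **Invariant orbital measures exist at the unipotent classes of `U(Φ₃)(L⁺_v)` at a NON-SPLIT place, unconditionally**: an orbital-measure family on
`G = U(Φ₃)(L⁺_v)` ADMISSIBLE at every class of unipotent representative (non-zero, `G`-invariant, finite on compacts — ★ `OrbitalMeasureFamily.IsAdmissibleOn`),
with regular members there.  ★ «RAO-EX» (`G` unimodular; `G_γ` unimodular because every element lies in a compact subgroup) with its hypothesis `hcent`
discharged by ★ «CENT-BDD» `exists_isCompact_subgroup_of_mem_centralizer_unipotent`.  No oddness ∕ unramifiedness hypothesis.
[cite: Rao1972, Theorem] [cite: Rogawski1990, §3.9 p. 32; §4.9 p. 54; §8.1 p. 112] -/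
theorem UnitaryGroup.exists_orbitalMeasureFamily_isAdmissibleOn_unipotent_antidiagOne_three_nonsplit
    (v : HeightOneSpectrum (𝓞 ↥(maximalRealSubfield L))) (w : UnitaryGroup.PlacesOver L v) (hsub : Subsingleton (UnitaryGroup.PlacesOver L v))
    [MeasurableSpace ((cmDatum L 3 (Matrix.of fun i j : Fin 3 => if i.val + j.val + 1 = 3 then (1 : L) else 0)).Local v)]
    [BorelSpace ((cmDatum L 3 (Matrix.of fun i j : Fin 3 => if i.val + j.val + 1 = 3 then (1 : L) else 0)).Local v)]
    [∀ γ : ((cmDatum L 3 (Matrix.of fun i j : Fin 3 => if i.val + j.val + 1 = 3 then (1 : L) else 0)).Local v),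
      MeasurableSpace (((cmDatum L 3 (Matrix.of fun i j : Fin 3 => if i.val + j.val + 1 = 3 then (1 : L) else 0)).Local v) ⧸
        Subgroup.centralizer ({γ} : Set ((cmDatum L 3 (Matrix.of fun i j : Fin 3 => if i.val + j.val + 1 = 3 then (1 : L) else 0)).Local v)))]
    [∀ γ : ((cmDatum L 3 (Matrix.of fun i j : Fin 3 => if i.val + j.val + 1 = 3 then (1 : L) else 0)).Local v),
      BorelSpace (((cmDatum L 3 (Matrix.of fun i j : Fin 3 => if i.val + j.val + 1 = 3 then (1 : L) else 0)).Local v) ⧸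
        Subgroup.centralizer ({γ} : Set ((cmDatum L 3 (Matrix.of fun i j : Fin 3 => if i.val + j.val + 1 = 3 then (1 : L) else 0)).Local v)))] :
    ∃ mU : OrbitalMeasureFamily ((cmDatum L 3 (Matrix.of fun i j : Fin 3 => if i.val + j.val + 1 = 3 then (1 : L) else 0)).Local v),
      mU.IsAdmissibleOn (fun γ : ((cmDatum L 3 (Matrix.of fun i j : Fin 3 => if i.val + j.val + 1 = 3 then (1 : L) else 0)).Local v) =>
        (((γ).val : GL (Fin 3) (UnitaryGroup.LocalRing L v)).val - 1) ^ 3 = 0) ∧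
      ∀ c : ConjClasses ((cmDatum L 3 (Matrix.of fun i j : Fin 3 => if i.val + j.val + 1 = 3 then (1 : L) else 0)).Local v),
        ((((Quotient.out c : ((cmDatum L 3 (Matrix.of fun i j : Fin 3 => if i.val + j.val + 1 = 3 then (1 : L) else 0)).Local v)).val :
          GL (Fin 3) (UnitaryGroup.LocalRing L v)).val - 1) ^ 3 = 0) → (mU c).Regular :=
  UnitaryGroup.exists_orbitalMeasureFamily_isAdmissibleOn_unipotent_antidiagOne_three L v
    fun _ hγ hγ1 g => exists_isCompact_subgroup_of_mem_centralizer_unipotent L v w hsub hγ hγ1 g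

set_option maxHeartbeats 400000 in
-- statement-heavy: four instance binders
/-- **The existence half of the organ ‹RAO›, unconditional, in the binder prefix of `stub_ShRao`** (odd non-split place `v`, `w ∣ v`, `2 ∈ 𝒪_w^×` — the oddness
binder is idle for existence and kept so that the organ closer is `obtain ⟨mU, hmU, -⟩ := …_odd' L v w hsub h2` followed by the Ranga Rao clause for this `mU`):
★ `…_odd` with `hcent` discharged by ★ «CENT-BDD». [cite: Rao1972, Theorem] [cite: Rogawski1990, §8.1 p. 112] -/
theorem UnitaryGroup.exists_orbitalMeasureFamily_isAdmissibleOn_unipotent_antidiagOne_three_odd' :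
    ∀ (L : Type) [Field L] [NumberField L] [IsCMField L] (v : HeightOneSpectrum (𝓞 ↥(maximalRealSubfield L))) (w : UnitaryGroup.PlacesOver L v),
      Subsingleton (UnitaryGroup.PlacesOver L v) → IsUnit (2 : 𝒪[w.1.adicCompletion L]) →
      ∀ [MeasurableSpace ((cmDatum L 3 (Matrix.of fun i j : Fin 3 => if i.val + j.val + 1 = 3 then (1 : L) else 0)).Local v)]
        [BorelSpace ((cmDatum L 3 (Matrix.of fun i j : Fin 3 => if i.val + j.val + 1 = 3 then (1 : L) else 0)).Local v)]
        [∀ γ : ((cmDatum L 3 (Matrix.of fun i j : Fin 3 => if i.val + j.val + 1 = 3 then (1 : L) else 0)).Local v),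
          MeasurableSpace (((cmDatum L 3 (Matrix.of fun i j : Fin 3 => if i.val + j.val + 1 = 3 then (1 : L) else 0)).Local v) ⧸
            Subgroup.centralizer ({γ} : Set ((cmDatum L 3 (Matrix.of fun i j : Fin 3 => if i.val + j.val + 1 = 3 then (1 : L) else 0)).Local v)))]
        [∀ γ : ((cmDatum L 3 (Matrix.of fun i j : Fin 3 => if i.val + j.val + 1 = 3 then (1 : L) else 0)).Local v),
          BorelSpace (((cmDatum L 3 (Matrix.of fun i j : Fin 3 => if i.val + j.val + 1 = 3 then (1 : L) else 0)).Local v) ⧸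
            Subgroup.centralizer ({γ} : Set ((cmDatum L 3 (Matrix.of fun i j : Fin 3 => if i.val + j.val + 1 = 3 then (1 : L) else 0)).Local v)))],
      ∃ mU : OrbitalMeasureFamily ((cmDatum L 3 (Matrix.of fun i j : Fin 3 => if i.val + j.val + 1 = 3 then (1 : L) else 0)).Local v),
        mU.IsAdmissibleOn (fun γ : ((cmDatum L 3 (Matrix.of fun i j : Fin 3 => if i.val + j.val + 1 = 3 then (1 : L) else 0)).Local v) =>
          (((γ).val : GL (Fin 3) (UnitaryGroup.LocalRing L v)).val - 1) ^ 3 = 0) ∧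
        ∀ c : ConjClasses ((cmDatum L 3 (Matrix.of fun i j : Fin 3 => if i.val + j.val + 1 = 3 then (1 : L) else 0)).Local v),
          ((((Quotient.out c : ((cmDatum L 3 (Matrix.of fun i j : Fin 3 => if i.val + j.val + 1 = 3 then (1 : L) else 0)).Local v)).val :
            GL (Fin 3) (UnitaryGroup.LocalRing L v)).val - 1) ^ 3 = 0) → (mU c).Regular :=
  fun L _ _ _ v w hsub _ _ _ _ _ =>
    UnitaryGroup.exists_orbitalMeasureFamily_isAdmissibleOn_unipotent_antidiagOne_three_nonsplit L v w hsub

end CM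

end Literature.NumberTheory.Rogawski1990

end
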